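import Summits.ResolutionOfSingularities.ResolutionOfSingularities.Theorems.NewtonDefectLadderClasses
import HarnessLib

/-!
# NewtonDefectLadderKernels — the kernels of lens-1 g11 «NewtonDefectLadder» (sha256 87fd3f33dd87743e; critic
row 77), VERBATIM

All proved, 0 sorry: monotonicity `torsorLU_anti`, `torsorLU_inf_iff_of_em`, `luAlphaPTorsor_iff_torsorLU`; (1) ANCHOR booking
`luAlphaPTorsor_iff_defectCoreLU : Valuative.LuAlphaPTorsor ↔ DefectCoreLU` (tree kernel
`PfaffLine.luAlphaPTorsor_iff_defectCoreFinal` BY NAME);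
kernel-closed ranges `splitCentreLU_holds`, `unitDerivativeLU_holds`, `baseDimLeTwoLU_holds`, `discreteLU_holds`,
`abhyankarLU_holds`,
`denseAbhyankarLU_holds`, `trdegLeOneLU_holds`, `trdegLeThreeLU_of_cossartPiltant2019`; (2) Newton cut
`luAlphaPTorsor_iff_newton`,
`defectCoreLU_iff_newton`; (3) order axis `wildDefectCoreLU_iff_order`, master kernel `luAlphaPTorsor_iff_ladder :
0641 ↔ NewtonTameLU ∧
TameOrderCoreLU ∧ KangarooCoreLU`; necessity `pieces_of_luAlphaPTorsor` / `pieces_of_picoverLocalModel` /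
`pieces_of_root`; ladder sanity
`faceDefectLT_zero_iff`, `faceDefectLT_one_iff`, `defectLELU_anti`, `defectLELU_zero_of_tame`.  Module docstring of
`Theorems.NewtonDefectLadderClasses` = the node.  [WRITER NOTE (decomp-res writer g5): verbatim; route-level `closes` dropped.]
(Sources: Kollar2007 Aside 3.57; Cossart2011; CossartPiltant2008; CossartPiltant2009; CossartPiltant2019 Prop. 4.4;
KnafKuhlmann2009 Thm 1.5;
Cutkosky2022 Thm 1.3; Giraud1975.)
-/

namespace Summit.ResolutionOfSingularities.ResolutionOfSingularities.Theorems.NewtonDefectLadderClasses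

open IsLocalRing MvPolynomial
open Summit.ResolutionOfSingularities.ResolutionOfSingularities.Theorems
open Summit.ResolutionOfSingularities.ResolutionOfSingularities.Theorems.PfaffLine
open Summit.ResolutionOfSingularities.ResolutionOfSingularities.Theses

/-- `defectBound` is monotone. [folklore] -/
theorem defectBound_mono {e e' : ℕ} (h : e ≤ e') : defectBound e ≤ defectBound e' := by
  unfold defectBound
  split_ifs <;> omega

section ClassesMoved

variable {B : Type} [CommRing B] [IsLocalRing B]

/-- Not order-tame = maximal order (definitional). [folklore] -/
theorem not_orderTameAt_iff (p : ℕ) (a : B) : ¬ OrderTameAt p a ↔ MaxOrderAt p a := by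
  simp [OrderTameAt, MaxOrderAt]

end ClassesMoved


/-! ## Kernels (all proved, 0 sorry) -/

section Kernels

/-- The host family is antitone in the side condition. [folklore] -/
theorem torsorLU_anti {Φ Ψ : Side}
    (hle : ∀ (p : ℕ) (k K : Type) [Field k] [CharP k p] [Field K] [Algebra k K]
      (O : ValuationSubring K) (A₀ : Subalgebra k K) (h₀ : A₀.toSubring ≤ O.toSubring) (t : K)
      (ht : t ^ p ∈ A₀), Φ p k K O A₀ h₀ t ht → Ψ p k K O A₀ h₀ t ht)
    (h : TorsorLU Ψ) : TorsorLU Φ := by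
  intro p hp k K _ _ _ _ O A₀ h₀ t ht hfg hfr hreg hΦ
  exact h p hp k K O A₀ h₀ t ht hfg hfr hreg (hle p k K O A₀ h₀ t ht hΦ)

/-- A side condition and its complement recompose the family (excluded middle). [folklore] -/
theorem torsorLU_inf_iff_of_em {Φ Ψ : Side} :
    TorsorLU Φ ↔ TorsorLU (Φ.inf Ψ) ∧ TorsorLU (Φ.inf Ψ.neg) := by
  constructor
  · intro h
    exact ⟨torsorLU_anti (fun _ _ _ _ _ _ _ _ _ _ _ _ hx => hx.1) h,
      torsorLU_anti (fun _ _ _ _ _ _ _ _ _ _ _ _ hx => hx.1) h⟩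
  · rintro ⟨h₁, h₂⟩
    intro p hp k K _ _ _ _ O A₀ h₀ t ht hfg hfr hreg hΦ
    by_cases hΨ : Ψ p k K O A₀ h₀ t ht
    · exact h₁ p hp k K O A₀ h₀ t ht hfg hfr hreg ⟨hΦ, hΨ⟩
    · exact h₂ p hp k K O A₀ h₀ t ht hfg hfr hreg ⟨hΦ, hΨ⟩

/-- The host is `TorsorLU` of the trivial side condition (binder bookkeeping only). [folklore] -/
theorem luAlphaPTorsor_iff_torsorLU :
    Valuative.LuAlphaPTorsor ↔ TorsorLU fun _ _ _ _ _ _ _ _ _ _ _ _ => True := by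
  constructor
  · intro h p hp k K _ _ _ _ O A₀ h₀ t ht hfg hfr hreg _
    exact h p hp k K O A₀ h₀ t hfg ht hfr hreg
  · intro h p hp k K _ _ _ _ O A₀ h₀ t hfg ht hfr hreg
    exact h p hp k K O A₀ h₀ t ht hfg hfr hreg trivial

/-- Every piece is a sub-family of the host. [folklore] -/
theorem torsorLU_of_luAlphaPTorsor (Φ : Side) (h : Valuative.LuAlphaPTorsor) : TorsorLU Φ :=
  torsorLU_anti (fun _ _ _ _ _ _ _ _ _ _ _ _ _ => trivial) (luAlphaPTorsor_iff_torsorLU.mp h)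

/-! ### 1. Anchor booking: the blocker is its defect core (tree kernel, by name) -/

/-- EQUIV LAYER: `LuAlphaPTorsor ↔ DefectCoreLU`, by `PfaffLine.luAlphaPTorsor_iff_defectCoreFinal`. [folklore] -/
theorem luAlphaPTorsor_iff_defectCoreLU : Valuative.LuAlphaPTorsor ↔ DefectCoreLU := by
  constructor
  · exact torsorLU_of_luAlphaPTorsor _
  · intro h
    refine luAlphaPTorsor_iff_defectCoreFinal.mpr ?_
    intro p hp k K _ _ _ _ O A₀ h₀ t hfg htp hfr hreg h1 h2 h3 h4 h5 h6 h7 h8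
    exact h p hp k K O A₀ h₀ t htp hfg hfr hreg ⟨h1, h2, h3, h4, h5, h6, h7, h8⟩

/-! ### Kernel-closed ranges (DECIDED-IN-TREE pieces: proofs, not cites) -/

/-- RANGE (kernel-closed): split centres — PROVED from the tree (`stub_birationalExit`). [folklore] -/
theorem splitCentreLU_holds : SplitCentreLU := by
  intro p hp k K _ _ _ _ O A₀ h₀ t ht hfg hfr hreg hsplit
  obtain ⟨c, hc⟩ := hsplit
  exact stub_birationalExit p hp k K O A₀ h₀ t hfg ht hfr hreg ⟨c, hc⟩

/-- RANGE (kernel-closed): a unit derivative — PROVED from the tree (07PG). [folklore] -/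
theorem unitDerivativeLU_holds : UnitDerivativeLU := by
  intro p hp k K _ _ _ _ O A₀ h₀ t ht hfg hfr hreg hδ
  exact luAlphaPTorsor_of_isUnit_derivation p hp k K O A₀ h₀ t hfg ht hfr hreg hδ

/-- RANGE (kernel-closed): base dimension ≤ 2 at the centre — PROVED from the tree. [folklore] -/
theorem baseDimLeTwoLU_holds : BaseDimLeTwoLU := by
  intro p hp k K _ _ _ _ O A₀ h₀ t ht hfg hfr hreg hdim
  exact luAlphaPTorsor_of_ringKrullDim_le_two p hp k K O A₀ h₀ t hfg ht hfr hreg hdim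

/-- RANGE (kernel-closed): discrete rank-one places, all fields and dimensions — PROVED from the tree. [folklore] -/
theorem discreteLU_holds : DiscreteLU := by
  intro p hp k K _ _ _ _ O A₀ h₀ t ht hfg hfr hreg hdisc
  exact luAlphaPTorsor_of_discrete p hp k K O A₀ h₀ t hfg ht hfr hreg hdisc

/-- (proof = the tree's `luAlphaPTorsor_of_isAbhyankarPlace_of_cutkosky2022`, inlined because that
module has no hub olean yet, fed with the PROVED fact `Cutkosky2022_Thm13_holds`.) [folklore] -/
theorem abhyankarLU_holds : AbhyankarLU := by
  intro p hp k K _ _ _ _ O A₀ h₀ t htp hfg hfr _ hAbh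
  have hC : Literature.AlgebraicGeometry.Resolution.Cutkosky2022_Thm13.{0} :=
    Literature.AlgebraicGeometry.Resolution.Cutkosky2022_Thm13_holds
  have htO : t ∈ O := mem_valuationSubring_of_pow_mem O hp.ne_zero (h₀ htp)
  have hRO : (Algebra.adjoin k (insert t (A₀ : Set K))).toSubring ≤ O.toSubring :=
    adjoin_insert_toSubring_le O.toSubring A₀ h₀ htO
  have hRfg : (Algebra.adjoin k (insert t (A₀ : Set K))).FG := fg_adjoin_insert hfg t
  haveI : IsFractionRing (Algebra.adjoin k (insert t (A₀ : Set K))) K := hfr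
  have hKfg : (⊤ : IntermediateField k K).FG :=
    intermediateField_top_fg_of_isFractionRing (Algebra.adjoin k (insert t (A₀ : Set K))) hRfg
  obtain ⟨A, h, hRA, hAfg, hfrA, hreg⟩ :=
    hC k K hKfg O (fun c => h₀ (A₀.algebraMap_mem c)) hAbh
      (Algebra.adjoin k (insert t (A₀ : Set K))) hRfg hRO
  exact ⟨A, h, (le_adjoin_insert A₀ t).trans hRA, hRA (mem_adjoin_insert A₀ t), hAfg, hfrA, hreg⟩

/-- RANGE (kernel-closed): dense in a finitely generated Abhyankar subfield — PROVED from the tree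
(Knaf–Kuhlmann). [folklore] -/
theorem denseAbhyankarLU_holds : DenseAbhyankarLU := by
  intro p hp k K _ _ _ _ O A₀ h₀ t ht hfg hfr _ hd
  exact denseRange3_crux p hp k K O A₀ h₀ t hfg ht hfr hd.1 hd.2

/-- RANGE (kernel-closed): transcendence degree ≤ 1 — PROVED from the tree. [folklore] -/
theorem trdegLeOneLU_holds : TrdegLeOneLU := by
  intro p hp k K _ _ _ _ O A₀ h₀ t ht hfg hfr _ hK
  exact luAlphaPTorsor_of_trdeg_le_one p hp k K O A₀ h₀ t hfg ht hfr hK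

/-- DECIDED-MOD-FACT: transcendence degree `≤ 3` from the named fact `CossartPiltant2019`. [folklore] -/
theorem trdegLeThreeLU_of_cossartPiltant2019
    (hCP : Literature.AlgebraicGeometry.Resolution.CossartPiltant2019.{0}) : TrdegLeThreeLU := by
  intro p hp k K _ _ _ _ O A₀ h₀ t ht hfg hfr _ hK
  exact luAlphaPTorsor_of_trdeg_le_three_of_cossartPiltant2019 hCP p hp k K O A₀ h₀ t hfg ht hfr hK

/-! ### 2. Newton cut (g10) and its cross with the defect core -/

/-- EXACT (excluded middle on the centre datum): host = Newton-tame ∧ Newton-wild. [folklore] -/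
theorem luAlphaPTorsor_iff_newton : Valuative.LuAlphaPTorsor ↔ NewtonTameLU ∧ NewtonWildLU := by
  rw [luAlphaPTorsor_iff_torsorLU,
    torsorLU_inf_iff_of_em (Ψ := pw fun p _ _ _ a => NewtonTameAt p a)]
  unfold NewtonTameLU NewtonWildLU
  constructor
  · rintro ⟨h₁, h₂⟩
    exact ⟨torsorLU_anti (fun _ _ _ _ _ _ _ _ _ _ _ _ hx => ⟨trivial, hx⟩) h₁,
      torsorLU_anti (fun _ _ _ _ _ _ _ _ _ _ _ _ hx => ⟨trivial, hx⟩) h₂⟩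
  · rintro ⟨h₁, h₂⟩
    exact ⟨torsorLU_anti (fun _ _ _ _ _ _ _ _ _ _ _ _ hx => hx.2) h₁,
      torsorLU_anti (fun _ _ _ _ _ _ _ _ _ _ _ _ hx => hx.2) h₂⟩

/-- CROSS KERNEL: defect core = (defect core ∧ Newton-tame) ∧ (defect core ∧ Newton-wild). [folklore] -/
theorem defectCoreLU_iff_newton : DefectCoreLU ↔ TameDefectCoreLU ∧ WildDefectCoreLU :=
  torsorLU_inf_iff_of_em

/-- The Newton-tame part of the core is below the g10 decided rung. [folklore] -/
theorem tameDefectCoreLU_of_newtonTameLU (h : NewtonTameLU) : TameDefectCoreLU :=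
  torsorLU_anti (fun _ _ _ _ _ _ _ _ _ _ _ _ hx => hx.2) h

/-- LOCATION: the blocker follows from the g10 decided rung and the wild defect core alone. [folklore] -/
theorem luAlphaPTorsor_of_newtonTame_of_wildDefectCore (hT : NewtonTameLU) (hW : WildDefectCoreLU) :
    Valuative.LuAlphaPTorsor :=
  luAlphaPTorsor_iff_defectCoreLU.mpr (defectCoreLU_iff_newton.mpr ⟨tameDefectCoreLU_of_newtonTameLU hT, hW⟩)

/-! ### 3. Order axis -/

/-- EXACT: wild defect core = order-tame part ∧ kangaroo (max-order) part. [folklore] -/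
theorem wildDefectCoreLU_iff_order : WildDefectCoreLU ↔ TameOrderCoreLU ∧ KangarooCoreLU := by
  unfold WildDefectCoreLU TameOrderCoreLU KangarooCoreLU
  rw [torsorLU_inf_iff_of_em (Ψ := pw fun p _ _ _ a => OrderTameAt p a)]
  constructor
  · rintro ⟨h₁, h₂⟩
    exact ⟨torsorLU_anti (fun _ _ _ _ _ _ _ _ _ _ _ _ hx => ⟨⟨hx.1, hx.2.1⟩, hx.2.2⟩) h₁,
      torsorLU_anti (fun _ _ _ _ _ _ _ _ _ _ _ _ hx => ⟨⟨hx.1, hx.2.1⟩, hx.2.2⟩) h₂⟩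
  · rintro ⟨h₁, h₂⟩
    exact ⟨torsorLU_anti (fun _ _ _ _ _ _ _ _ _ _ _ _ hx => ⟨hx.1.1, hx.1.2, hx.2⟩) h₁,
      torsorLU_anti (fun _ _ _ _ _ _ _ _ _ _ _ _ hx => ⟨hx.1.1, hx.1.2, hx.2⟩) h₂⟩

/-- MASTER KERNEL (EXACT three-piece decomposition of the blocker):
decided rung (g10) ∧ attackable rung (E2) ∧ located residual. [folklore] -/
theorem luAlphaPTorsor_iff_ladder :
    Valuative.LuAlphaPTorsor ↔ NewtonTameLU ∧ TameOrderCoreLU ∧ KangarooCoreLU := by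
  constructor
  · intro h
    exact ⟨(luAlphaPTorsor_iff_newton.mp h).1,
      wildDefectCoreLU_iff_order.mp (torsorLU_of_luAlphaPTorsor _ h)⟩
  · rintro ⟨hT, hO, hK⟩
    exact luAlphaPTorsor_of_newtonTame_of_wildDefectCore hT (wildDefectCoreLU_iff_order.mpr ⟨hO, hK⟩)

/-! ### Necessity from the ROOT (every piece) -/

/-- NECESSITY: the host 0641 implies every piece and recomposition (each is a restriction). [folklore] -/
theorem pieces_of_luAlphaPTorsor (h : Valuative.LuAlphaPTorsor) :
    DefectCoreLU ∧ NewtonTameLU ∧ NewtonWildLU ∧ TameDefectCoreLU ∧ WildDefectCoreLU ∧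
      TameOrderCoreLU ∧ KangarooCoreLU ∧ (∀ e, DefectLELU e) ∧ CleanCentreLU :=
  ⟨torsorLU_of_luAlphaPTorsor _ h, torsorLU_of_luAlphaPTorsor _ h, torsorLU_of_luAlphaPTorsor _ h,
    torsorLU_of_luAlphaPTorsor _ h, torsorLU_of_luAlphaPTorsor _ h, torsorLU_of_luAlphaPTorsor _ h,
    torsorLU_of_luAlphaPTorsor _ h, fun _ => torsorLU_of_luAlphaPTorsor _ h,
    torsorLU_of_luAlphaPTorsor _ h⟩

/-- NECESSITY from `PAlteration.PicoverLocalModel` (tree kernel `luAlphaPTorsor_of_picoverLocalModel`). [folklore] -/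
theorem pieces_of_picoverLocalModel (hPLM : PAlteration.PicoverLocalModel) :
    DefectCoreLU ∧ NewtonTameLU ∧ NewtonWildLU ∧ TameDefectCoreLU ∧ WildDefectCoreLU ∧
      TameOrderCoreLU ∧ KangarooCoreLU ∧ (∀ e, DefectLELU e) ∧ CleanCentreLU :=
  pieces_of_luAlphaPTorsor (luAlphaPTorsor_of_picoverLocalModel hPLM)

/-- NECESSITY from the ROOT (tree kernel `picoverLocalModel_of_resolutionInChar`, p89468). [folklore] -/
theorem pieces_of_root (hR : _root_.ResolutionOfSingularities) :
    DefectCoreLU ∧ NewtonTameLU ∧ NewtonWildLU ∧ TameDefectCoreLU ∧ WildDefectCoreLU ∧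
      TameOrderCoreLU ∧ KangarooCoreLU ∧ (∀ e, DefectLELU e) ∧ CleanCentreLU :=
  pieces_of_picoverLocalModel fun p hp k _ _ R _ _ _ hft hreg a =>
    picoverLocalModel_of_resolutionInChar p hp (hR p hp) k R hft hreg a

/-! ### Ladder sanity (re-indexed) -/

/-- Rung `0` of the face defect is «the log-Jacobian ideal contains a monomial» (Kouchnirenko). [folklore] -/
theorem faceDefectLT_zero_iff {d : ℕ} {κ : Type} [Field κ] (G : MvPolynomial (Fin d) κ) :
    faceDefectLT 0 G ↔ ∃ N : ℕ, (∏ i : Fin d, X i) ^ N ∈ logJacobian G := by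
  unfold faceDefectLT defectBound
  set r : MvPolynomial (Fin d) κ ⧸ logJacobian G :=
    Ideal.Quotient.mk (logJacobian G) (∏ i : Fin d, X i) with hr
  have key : Subsingleton (Localization.Away r) ↔ ∃ N : ℕ, (∏ i : Fin d, X i) ^ N ∈ logJacobian G := by
    rw [IsLocalization.subsingleton_iff (M := Submonoid.powers r) (S := Localization.Away r),
      Submonoid.mem_powers_iff]
    constructor
    · rintro ⟨N, hN⟩
      refine ⟨N, ?_⟩
      rw [← Ideal.Quotient.eq_zero_iff_mem, map_pow, ← hr]
      exact hN
    · rintro ⟨N, hN⟩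
      refine ⟨N, ?_⟩
      rw [hr, ← map_pow, Ideal.Quotient.eq_zero_iff_mem]
      exact hN
  have h0 : ((((if (0:ℕ) = 0 then 0 else 0 + 1 : ℕ)) : ℕ∞) : WithBot ℕ∞) = 0 := by norm_cast
  rw [h0]
  constructor
  · intro hlt
    apply key.mp
    by_contra hns
    rw [not_subsingleton_iff_nontrivial] at hns
    exact absurd hlt (not_lt.mpr (ringKrullDim_nonneg_of_nontrivial (R := Localization.Away r)))
  · intro hN
    haveI := key.mpr hN
    rw [ringKrullDim_eq_bot_of_subsingleton]
    exact WithBot.bot_lt_coe _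

/-- Rung `1` (re-indexed) is «critical scheme of dimension ≤ 1» = finitely many critical orbits. [folklore] -/
theorem faceDefectLT_one_iff {d : ℕ} {κ : Type} [Field κ] (G : MvPolynomial (Fin d) κ) :
    faceDefectLT 1 G ↔
      ringKrullDim (Localization.Away (Ideal.Quotient.mk (logJacobian G) (∏ i : Fin d, X i))) < 2 := by
  unfold faceDefectLT defectBound
  norm_num

/-- The face-defect ladder is monotone in the index. [folklore] -/
theorem faceDefectLT_mono {d : ℕ} {κ : Type} [Field κ] {e e' : ℕ} (hle : e ≤ e')
    (G : MvPolynomial (Fin d) κ) (h : faceDefectLT e G) : faceDefectLT e' G := by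
  unfold faceDefectLT at *
  exact lt_of_lt_of_le h (by exact_mod_cast defectBound_mono hle)

/-- The Newton-defect ladder is monotone in the index. [folklore] -/
theorem newtonDefectLT_mono {B : Type} [CommRing B] [IsLocalRing B] {d e e' : ℕ} (hle : e ≤ e')
    (x : Fin d → B) (g : B) (h : NewtonDefectLT e x g) : NewtonDefectLT e' x g := by
  intro w hw
  obtain ⟨n, c, hc, hδ⟩ := h w hw
  exact ⟨n, c, hc, faceDefectLT_mono hle _ hδ⟩

/-- `DefectLTAt` is monotone in the index. [folklore] -/
theorem defectLTAt_mono {B : Type} [CommRing B] [IsLocalRing B] {p e e' : ℕ} (hle : e ≤ e')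
    (a : B) (h : DefectLTAt p e a) : DefectLTAt p e' a := by
  obtain ⟨d, x, c, hx, hm, hN⟩ := h
  exact ⟨d, x, c, hx, hm, newtonDefectLT_mono hle x _ hN⟩

/-- `DefectLELU` is antitone in the index. [folklore] -/
theorem defectLELU_anti {e e' : ℕ} (hle : e ≤ e') (h : DefectLELU e') : DefectLELU e :=
  torsorLU_anti (fun _ _ _ _ _ _ _ _ _ _ _ _ ha => defectLTAt_mono hle _ ha) h

/-- The decided rung contains defect-zero. [folklore] -/
theorem defectLELU_zero_of_tame (h : NewtonTameLU) : DefectLELU 0 :=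
  torsorLU_anti (fun _ _ _ _ _ _ _ _ _ _ _ _ ha => Or.inr (Or.inr ha)) h

/-- The split part of the tame rung is kernel-decided. [folklore] -/
theorem splitPart_of_newtonTame_decided : TorsorLU (pw fun p _ _ _ a => SplitAt p a) :=
  splitCentreLU_holds

end Kernels

end Summit.ResolutionOfSingularities.ResolutionOfSingularities.Theorems.NewtonDefectLadderClasses
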